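import Literature.Probability.LatticeModels.LatticeAnimalsGraph
import Mathlib.Algebra.BigOperators.Ring.Finset
import Mathlib.Algebra.Order.BigOperators.Group.Finset
import Mathlib.Analysis.SpecialFunctions.Pow.Real
import HarnessLib

/-!
# Families of vertex sets all of whose components are marked (Gottesman's `𝓜(S)`): a generating-function bound

Index of sources: `[cite: Gottesman2014]` = D. Gottesman, *Fault-tolerant quantum computation with constant overhead*, QIC 14 (2014),
arXiv:1310.2984, §4 Lemma 2 (the family `𝓜(S)` and the count `#{W ∈ 𝓜(S) : |W| = t} ≤ (ed)^t/(e d^{|S|})`);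
`[cite: FawziGrospellierLeverrier2018FT]` = Fawzi–Grospellier–Leverrier, FOCS 2018 / arXiv:1808.03821, Def. 23 and eq. (M(S) count) (p0020 L7-16:
"`𝓜(S)` = the set of all subsets `W ⊆ V` such that `S ⊆ W` and such that any connected component `W'` of `W` in `𝒢` satisfies `W' ∩ S ≠ ∅`"),
used in the proof of Thm. 13 (p0022: "`≤ 2 Σ_{W ∈ 𝓜(S)} p₁^{|W|}/(1 − p₁^{c₀}) ≤ …`"); `[cite: FriedliVelenik2017]` eq. (5.27) (connected sets through a
vertex; tree `card_le_pow_of_isGraphConnected`).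

Topic `Literature/Probability/LatticeModels` (generic graph combinatorics; consumer: venture QEC line L-SSF-NOISY, the witness union bound of FGL18b
Thm. 13). For a finite graph `G` with degrees `≤ Δ`, a mark set `S` and `0 ≤ y ≤ 1`, the family
`𝓜(S) = {W : S ⊆ W, every vertex of W is joined inside W to a vertex of S}` satisfies the generating-function bound
`Σ_{W ∈ 𝓜(S)} y^{|W|} ≤ (1 + F(y))^{|S|}`, `F(y) = Σ_{k=1}^{|V|} Δ^{2(k−1)} y^k`: write `W` as the DISJOINT union of its connected components,
label each component by a canonical root in `S` (every component meets `S`), so that `W ↦ (s ↦ the component rooted at s, or ∅)` is injective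
into `Π_{s ∈ S} ({∅} ∪ {connected T ∋ s})` and `y^{|W|} = Π_s y^{|component|}`; then `Π_s Σ_T y^{|T|} ≤ (1 + F(y))^{|S|}` by the Peierls count. This is
WEAKER than Gottesman's Lemma 2 (which exploits `|W| ≥ |S|` inside the count and gives `(ed)^t/(e d^{|S|})`); combined with `y^{|W|} ≤ y^{|S|/2}(√y)^{|W|}`
it yields `Σ_{W ∈ 𝓜(S)} y^{|W|} ≤ (√y(1 + F(√y)))^{|S|}`, the shape needed for a local-stochastic conclusion (constant exponent halved).

* `sum_pow_card_marked_le` — `Σ_{W ∈ 𝓜(S)} y^{|W|} ≤ (1 + Σ_{k=1}^{|V|} Δ^{2(k−1)} y^k)^{|S|}`;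
* `sum_pow_card_marked_le_sqrt` — `Σ_{W ∈ 𝓜(S)} y^{|W|} ≤ (√y·(1 + Σ_{k=1}^{|V|} Δ^{2(k−1)} (√y)^k))^{|S|}`.

PROVED (kernel); no definitions (`𝓜(S)` is written as a `Finset.filter`), no named facts. Statement ours (a weakening of Gottesman's Lemma 2).
-/

namespace Literature.Probability.LatticeModels

open Finset SimpleGraph

variable {V : Type*} [Fintype V] [DecidableEq V] {G : SimpleGraph V} [DecidableRel G.Adj]

/-- **Generating-function bound for Gottesman's `𝓜(S)`** (weak form): for degrees `≤ Δ`, marks `S` and `0 ≤ y`,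
`Σ_{W ∈ 𝓜(S)} y^{|W|} ≤ (1 + Σ_{k=1}^{|V|} Δ^{2(k−1)} y^k)^{|S|}`, where `W ∈ 𝓜(S)` iff `S ⊆ W` and every vertex of `W` is joined to some vertex of `S`
by a path of `G` inside `W` (equivalently: every connected component of `W` meets `S`). Proof: components with canonical roots in `S` (see the module
docstring). [cite: Gottesman2014, Lemma 2 (weaker form)] [cite: FawziGrospellierLeverrier2018FT, Def 23 (arXiv p0020 L7-16)] -/
theorem sum_pow_card_marked_le {Δ : ℕ} (hΔ : ∀ x, G.degree x ≤ Δ) (S : Finset V)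
    [DecidablePred fun W : Finset V => S ⊆ W ∧ ∀ q ∈ W, ∃ s ∈ S,
      Relation.ReflTransGen (fun a b => G.Adj a b ∧ a ∈ W ∧ b ∈ W) q s]
    {y : ℝ} (hy0 : 0 ≤ y) :
    ∑ W ∈ univ.filter (fun W : Finset V => S ⊆ W ∧ ∀ q ∈ W, ∃ s ∈ S,
        Relation.ReflTransGen (fun a b => G.Adj a b ∧ a ∈ W ∧ b ∈ W) q s), y ^ W.card
      ≤ (1 + ∑ k ∈ Finset.Icc 1 (Fintype.card V), (Δ : ℝ) ^ (2 * (k - 1)) * y ^ k) ^ S.card := by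
  classical
  set F : ℝ := ∑ k ∈ Finset.Icc 1 (Fintype.card V), (Δ : ℝ) ^ (2 * (k - 1)) * y ^ k with hFdef
  have hF0 : 0 ≤ F := Finset.sum_nonneg fun k _ => by positivity
  set M : Finset (Finset V) := univ.filter (fun W : Finset V => S ⊆ W ∧ ∀ q ∈ W, ∃ s ∈ S,
      Relation.ReflTransGen (fun a b => G.Adj a b ∧ a ∈ W ∧ b ∈ W) q s) with hMdef
  -- the empty mark set: `𝓜(∅) = {∅}`
  by_cases hS : S = ∅
  · subst hS
    have hM : M ⊆ {∅} := by
      intro W hW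
      rw [hMdef, Finset.mem_filter] at hW
      rw [Finset.mem_singleton, Finset.eq_empty_iff_forall_notMem]
      intro q hq
      obtain ⟨s, hs, -⟩ := hW.2.2 q hq
      simp at hs
    calc ∑ W ∈ M, y ^ W.card ≤ ∑ W ∈ ({∅} : Finset (Finset V)), y ^ W.card :=
          Finset.sum_le_sum_of_subset_of_nonneg hM fun W _ _ => pow_nonneg hy0 _
      _ = 1 := by simp
      _ ≤ (1 + F) ^ (∅ : Finset V).card := by simp
  obtain ⟨s₀, hs₀⟩ := Finset.nonempty_iff_ne_empty.2 hS
  -- components of a set `W` and canonical roots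
  let joined : Finset V → V → V → Prop := fun W a b =>
    Relation.ReflTransGen (fun x z => G.Adj x z ∧ x ∈ W ∧ z ∈ W) a b
  let comp : Finset V → V → Finset V := fun W q => W.filter fun q' => joined W q q'
  have mem_comp : ∀ {W : Finset V} {q q' : V}, q' ∈ comp W q ↔ q' ∈ W ∧ joined W q q' := by
    intro W q q'; simp only [comp, Finset.mem_filter]
  have comp_subset : ∀ (W : Finset V) (q : V), comp W q ⊆ W := fun W q q' hq' => (mem_comp.1 hq').1
  have self_mem : ∀ {W : Finset V} {q : V}, q ∈ W → q ∈ comp W q :=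
    fun hq => mem_comp.2 ⟨hq, Relation.ReflTransGen.refl⟩
  have jsymm : ∀ {W : Finset V} {a b : V}, joined W a b → joined W b a := by
    intro W a b hab
    haveI : Std.Symm (fun x z => G.Adj x z ∧ x ∈ W ∧ z ∈ W) := ⟨fun x z hxz => ⟨hxz.1.symm, hxz.2.2, hxz.2.1⟩⟩
    exact Std.Symm.symm _ _ hab
  have comp_eq : ∀ {W : Finset V} {q q' : V}, q' ∈ comp W q → comp W q' = comp W q := by
    intro W q q' h
    rw [mem_comp] at h
    ext z
    rw [mem_comp, mem_comp]
    constructor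
    · rintro ⟨hz, hqz⟩; exact ⟨hz, h.2.trans hqz⟩
    · rintro ⟨hz, hqz⟩; exact ⟨hz, (jsymm h.2).trans hqz⟩
  have closed : ∀ {W : Finset V} {q a b : V}, a ∈ comp W q → b ∈ W → G.Adj a b → b ∈ comp W q := by
    intro W q a b ha hb hab
    rw [mem_comp] at ha ⊢
    exact ⟨hb, ha.2.tail ⟨hab, ha.1, hb⟩⟩
  have conn : ∀ {W : Finset V} {q : V}, q ∈ W → IsGraphConnected G (comp W q) := by
    intro W q hq
    rw [isGraphConnected_iff_reflTransGen (hv := self_mem hq)]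
    intro z hz
    rw [mem_comp] at hz
    have key : ∀ z, joined W q z →
        Relation.ReflTransGen (fun a b => G.Adj a b ∧ a ∈ comp W q ∧ b ∈ comp W q) q z := by
      intro z hz
      induction hz with
      | refl => exact Relation.ReflTransGen.refl
      | @tail u v hu huv ih =>
        have hu' : u ∈ comp W q := mem_comp.2 ⟨huv.2.1, hu⟩
        exact ih.tail ⟨huv.1, hu', closed hu' huv.2.2 huv.1⟩
    exact key z hz.2
  -- canonical root of a vertex set: some marked vertex in it (if any)
  let root : Finset V → V := fun T => if h : (T ∩ S).Nonempty then h.choose else s₀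
  have root_mem : ∀ {T : Finset V}, (T ∩ S).Nonempty → root T ∈ T ∩ S := by
    intro T h
    simp only [root, dif_pos h]
    exact h.choose_spec
  -- the encoding `g_W : V → Finset V`
  let g : Finset V → V → Finset V := fun W s =>
    if s ∈ S ∧ root (comp W s) = s then comp W s else ∅
  -- candidate values: `∅` or a connected set through `s`
  let A : V → Finset (Finset V) := fun s =>
    if s ∈ S then insert ∅ (univ.filter fun T : Finset V => s ∈ T ∧ IsGraphConnected G T) else {∅}
  -- (a) `g_W` takes values in `A`
  have hgA : ∀ W ∈ M, g W ∈ Fintype.piFinset A := by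
    intro W hW
    rw [hMdef, Finset.mem_filter] at hW
    rw [Fintype.mem_piFinset]
    intro s
    by_cases hs : s ∈ S
    · simp only [g, A, hs, true_and, if_true]
      by_cases hr : root (comp W s) = s
      · rw [if_pos hr, Finset.mem_insert]
        right
        rw [Finset.mem_filter]
        exact ⟨Finset.mem_univ _, self_mem (hW.2.1 hs), conn (hW.2.1 hs)⟩
      · rw [if_neg hr]; exact Finset.mem_insert_self _ _
    · simp [g, A, hs]
  -- (b) `W` is the disjoint union of the `g_W s`, `s ∈ S`
  have hcover : ∀ W ∈ M, W = S.biUnion (g W) := by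
    intro W hW
    rw [hMdef, Finset.mem_filter] at hW
    ext q
    rw [Finset.mem_biUnion]
    constructor
    · intro hq
      obtain ⟨s, hs, hqs⟩ := hW.2.2 q hq
      -- the component `T` of `q` contains `s`, hence is rooted at `r := root T ∈ S`
      have hsT : s ∈ comp W q := mem_comp.2 ⟨hW.2.1 hs, hqs⟩
      have hne : (comp W q ∩ S).Nonempty := ⟨s, Finset.mem_inter.2 ⟨hsT, hs⟩⟩
      have hr := root_mem hne
      set r := root (comp W q) with hrdef
      have hrT : r ∈ comp W q := (Finset.mem_inter.1 hr).1
      have hrS : r ∈ S := (Finset.mem_inter.1 hr).2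
      have hcomp : comp W r = comp W q := comp_eq hrT
      refine ⟨r, hrS, ?_⟩
      simp only [g, hrS, true_and, hcomp]
      rw [if_pos hrdef.symm]
      exact self_mem hq
    · rintro ⟨s, hs, hq⟩
      simp only [g, hs, true_and] at hq
      by_cases hr : root (comp W s) = s
      · rw [if_pos hr] at hq; exact comp_subset W s hq
      · rw [if_neg hr] at hq; simp at hq
  have hdisj : ∀ W ∈ M, (S : Set V).PairwiseDisjoint (g W) := by
    intro W hW s hs s' hs' hne
    rw [Function.onFun, Finset.disjoint_left]
    intro q hq hq'
    have hs0 : s ∈ S := hs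
    have hs0' : s' ∈ S := hs'
    simp only [g, hs0, hs0', true_and] at hq hq'
    by_cases hr : root (comp W s) = s
    · by_cases hr' : root (comp W s') = s'
      · rw [if_pos hr] at hq
        rw [if_pos hr'] at hq'
        have h1 := comp_eq hq
        have h2 := comp_eq hq'
        -- same component, hence same root
        have : comp W s = comp W s' := h1.symm.trans h2
        apply hne
        rw [← hr, ← hr', this]
      · rw [if_neg hr'] at hq'; simp at hq'
    · rw [if_neg hr] at hq; simp at hq
  have hcard : ∀ W ∈ M, W.card = ∑ s ∈ S, (g W s).card := by
    intro W hW
    conv_lhs => rw [hcover W hW]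
    exact Finset.card_biUnion (hdisj W hW)
  -- (c) hence `y^{|W|} = Π_{s : V} y^{|g_W s|}` (factors `1` off `S`)
  have hpow : ∀ W ∈ M, y ^ W.card = ∏ s, y ^ (g W s).card := by
    intro W hW
    rw [Finset.prod_pow_eq_pow_sum, hcard W hW]
    congr 1
    refine Finset.sum_subset (Finset.subset_univ S) ?_
    intro s _ hs
    simp [g, hs]
  -- (d) injectivity of `W ↦ g_W` on `M`
  have hinj : Set.InjOn g (M : Set (Finset V)) := by
    intro W hW W' hW' h
    rw [hcover W hW, hcover W' hW', h]
  -- (e) the sum over `M` is dominated by the sum over all admissible `g`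
  have hstep : ∑ W ∈ M, y ^ W.card ≤ ∑ f ∈ Fintype.piFinset A, ∏ s, y ^ (f s).card := by
    rw [Finset.sum_congr rfl hpow,
      show (∑ x ∈ M, ∏ s, y ^ (g x s).card) = ∑ f ∈ M.image g, ∏ s, y ^ (f s).card from
        (Finset.sum_image (f := fun f : V → Finset V => ∏ s, y ^ (f s).card) hinj).symm]
    refine Finset.sum_le_sum_of_subset_of_nonneg ?_ fun f _ _ => Finset.prod_nonneg fun s _ => pow_nonneg hy0 _
    intro f hf
    obtain ⟨W, hW, rfl⟩ := Finset.mem_image.1 hf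
    exact hgA W hW
  -- (f) the sum over admissible `g` factorises
  have hfact : ∑ f ∈ Fintype.piFinset A, ∏ s, y ^ (f s).card = ∏ s, ∑ T ∈ A s, y ^ T.card :=
    (Finset.prod_univ_sum A fun s T => y ^ T.card).symm
  -- (g) each factor is `≤ 1 + F` on `S` and `= 1` off `S`
  have hconnsum : ∀ s : V, ∑ T ∈ univ.filter (fun T : Finset V => s ∈ T ∧ IsGraphConnected G T), y ^ T.card ≤ F := by
    intro s
    set Cs := univ.filter (fun T : Finset V => s ∈ T ∧ IsGraphConnected G T) with hCs
    have hmaps : ∀ T ∈ Cs, T.card ∈ Finset.Icc 1 (Fintype.card V) := by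
      intro T hT
      rw [hCs, Finset.mem_filter] at hT
      rw [Finset.mem_Icc]
      exact ⟨Finset.card_pos.2 ⟨s, hT.2.1⟩, Finset.card_le_univ T⟩
    rw [← Finset.sum_fiberwise_of_maps_to hmaps]
    refine Finset.sum_le_sum fun k hk => ?_
    have hk1 : 1 ≤ k := (Finset.mem_Icc.1 hk).1
    have hfib : ∑ T ∈ Cs.filter (fun T => T.card = k), y ^ T.card
        = ((Cs.filter fun T => T.card = k).card : ℝ) * y ^ k := by
      rw [Finset.sum_congr rfl fun T hT => by rw [(Finset.mem_filter.1 hT).2], Finset.sum_const, nsmul_eq_mul]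
    rw [hfib]
    refine mul_le_mul_of_nonneg_right ?_ (pow_nonneg hy0 _)
    have hcount := card_le_pow_of_isGraphConnected (G := G) hΔ (v := s) (n := k) (Cs.filter fun T => T.card = k)
      (fun T hT => by
        rw [Finset.mem_filter, hCs, Finset.mem_filter] at hT
        exact ⟨hT.1.2.1, hT.2, hT.1.2.2⟩)
    exact_mod_cast hcount
  have hfactor : ∀ s : V, ∑ T ∈ A s, y ^ T.card ≤ if s ∈ S then 1 + F else 1 := by
    intro s
    by_cases hs : s ∈ S
    · simp only [A, hs, if_true]
      rw [Finset.sum_insert]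
      · simp only [Finset.card_empty, pow_zero]
        linarith [hconnsum s]
      · intro h
        rw [Finset.mem_filter] at h
        exact Finset.notMem_empty s h.2.1
    · simp [A, hs]
  have hprod : ∏ s, ∑ T ∈ A s, y ^ T.card ≤ ∏ s : V, (if s ∈ S then 1 + F else (1 : ℝ)) :=
    Finset.prod_le_prod (fun s _ => Finset.sum_nonneg fun T _ => pow_nonneg hy0 _) fun s _ => hfactor s
  have hrhs : ∏ s : V, (if s ∈ S then 1 + F else (1 : ℝ)) = (1 + F) ^ S.card := by
    rw [Finset.prod_ite, Finset.prod_const_one, mul_one, Finset.prod_const]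
    congr 1
    rw [Finset.filter_mem_eq_inter, Finset.univ_inter]
  calc ∑ W ∈ M, y ^ W.card ≤ ∑ f ∈ Fintype.piFinset A, ∏ s, y ^ (f s).card := hstep
    _ = ∏ s, ∑ T ∈ A s, y ^ T.card := hfact
    _ ≤ ∏ s : V, (if s ∈ S then 1 + F else (1 : ℝ)) := hprod
    _ = (1 + F) ^ S.card := hrhs

/-- **The same with the factor `y^{|S|/2}` extracted** (`|W| ≥ |S|` for `W ∈ 𝓜(S)`, so `y^{|W|} ≤ y^{|S|/2}·(√y)^{|W|}` for `y ≤ 1`):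
`Σ_{W ∈ 𝓜(S)} y^{|W|} ≤ (√y·(1 + Σ_{k=1}^{|V|} Δ^{2(k−1)}(√y)^k))^{|S|}` — the shape `(K·√y)^{|S|}` used for a local-stochastic conclusion.
[cite: Gottesman2014, Lemma 2 (weaker form)] [cite: FawziGrospellierLeverrier2018FT, proof of Thm 13 (sum over 𝓜(S); arXiv p0022)] -/
theorem sum_pow_card_marked_le_sqrt {Δ : ℕ} (hΔ : ∀ x, G.degree x ≤ Δ) (S : Finset V)
    [DecidablePred fun W : Finset V => S ⊆ W ∧ ∀ q ∈ W, ∃ s ∈ S,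
      Relation.ReflTransGen (fun a b => G.Adj a b ∧ a ∈ W ∧ b ∈ W) q s]
    {y : ℝ} (hy0 : 0 ≤ y) (hy1 : y ≤ 1) :
    ∑ W ∈ univ.filter (fun W : Finset V => S ⊆ W ∧ ∀ q ∈ W, ∃ s ∈ S,
        Relation.ReflTransGen (fun a b => G.Adj a b ∧ a ∈ W ∧ b ∈ W) q s), y ^ W.card
      ≤ (Real.sqrt y * (1 + ∑ k ∈ Finset.Icc 1 (Fintype.card V), (Δ : ℝ) ^ (2 * (k - 1)) * (Real.sqrt y) ^ k)) ^ S.card := by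
  classical
  have hsy0 : 0 ≤ Real.sqrt y := Real.sqrt_nonneg y
  have hsy1 : Real.sqrt y ≤ 1 := by simpa using Real.sqrt_le_sqrt hy1
  have hmain := sum_pow_card_marked_le (G := G) hΔ S hsy0
  -- termwise: `y^{|W|} = (√y)^{|W|}·(√y)^{|W|} ≤ (√y)^{|S|}·(√y)^{|W|}` since `|S| ≤ |W|`
  have hterm : ∀ W ∈ univ.filter (fun W : Finset V => S ⊆ W ∧ ∀ q ∈ W, ∃ s ∈ S,
      Relation.ReflTransGen (fun a b => G.Adj a b ∧ a ∈ W ∧ b ∈ W) q s),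
      y ^ W.card ≤ (Real.sqrt y) ^ S.card * (Real.sqrt y) ^ W.card := by
    intro W hW
    rw [Finset.mem_filter] at hW
    have hSW : S.card ≤ W.card := Finset.card_le_card hW.2.1
    have hy : y ^ W.card = (Real.sqrt y) ^ W.card * (Real.sqrt y) ^ W.card := by
      rw [← mul_pow, Real.mul_self_sqrt hy0]
    rw [hy]
    exact mul_le_mul_of_nonneg_right (pow_le_pow_of_le_one hsy0 hsy1 hSW) (pow_nonneg hsy0 _)
  refine (Finset.sum_le_sum hterm).trans ?_
  rw [← Finset.mul_sum, mul_pow]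
  exact mul_le_mul_of_nonneg_left hmain (pow_nonneg hsy0 _)

end Literature.Probability.LatticeModels
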